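import Summits.AnomalousDissipation.AnomalousDissipation.Theorems.SawtoothPulseCascadeK1LocalisedCascadeHalfStepVT
import Mathlib.MeasureTheory.Integral.IntervalIntegral.Periodic

/-!
# K1loc, line `Spectral` / thin start — helper: THE V HALF-STEP WITH THE TWIST CUT-OFF, OSCILLATORY CORNER SCALE (S-D, «HalfStepVO»)

Helper file of the prover lane on the crux `K1LocalisedCascade` (stmt-AnomalousDissipation-19491), route
`SawtoothPulseCascade` (S-D fibre ledger; memo v14 §3(c)).  Twin of `…HalfStepVT.sum_window_sq_norm_vstep_twist_le` with the
SAME conclusion shape, in which the two kernel-tail estimates that fix the corner scale `d₀` are replaced: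
* the mid-band part of the EXACT chirp off the corners is taken from an OSCILLATORY pointwise hypothesis
  `hosc : ‖(ψ_n ⋆ g₀ⁿ)(t)‖ ≤ β/r + φ` whenever the phase `2πN_jt` is `2πN_jr`-far from every corner (discharged for maximal-ramp
  trapezoids by `…ChirpCutoffOsc.norm_circleCutoff_exactChirp_osc_le_of_far` with `β = 1/(2πD)`, `φ = 2N_j/(πD)`), instead of the
  absolute tail `2∫_{‖s‖≥d/2}|k_ψ| ≤ 4τ/d`;
* the rounding remainder `ψ_n ⋆ (g_n − g₀ⁿ)` is `η·A` PLUS the kernel over the `Mδ_j`-corner ZONES only (measure `≤ 2Mδ_j/π`), where the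
  pointwise kernel bound `hκ : |k_ψ(s)| ≤ κ/‖s‖²` (trapezoid: `κ = 1/(4D)`, `…TrapezoidTail`) gives `≤ 16κMδ_j/(π d²)`, instead of
  `2·(far sup 2)·∫_{‖s‖≥d/2}|k_ψ| ≤ 4τ/d`.
**`sum_window_sq_norm_vstep_osc_le`** — under `β + 16κMδ_j/(πd₀) ≤ A·d₀`, `Mδ_j < πN_j d₀`, `ε₀ ≥ A·2π|nG|e^{−M²/2}/(2N_j) + φ`:
`Σ_{k∈W}‖𝓕(b∘Φ_V)(k)‖² ≤ ((∫|k_χ|)·(ε₀ + A·√(2N_j·4d₀)) + √(Σ_{n∈F}∫‖A¹_n(b − T_χ b)‖²))²`.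
With `δ` small the admissible scale is `d₀ ≈ β/A = 1/(2πAD)` (landed: `8τ/A = 4/(AD)`): junk energy `÷ 8π`.
No definitions; no statement about the crux. [cite: Grafakos2014, Prop. 3.1.2 (5), §3.1.3]
[cite: ElgindiLissMattingly2025, §1 (slope ±1 branches)] [problem: turb]
-/

-- `Summit.<Summit>.<Problem>`: single-conjunct summit, the duplicate namespace segment is deliberate.
set_option linter.dupNamespace false

noncomputable section

namespace Summit.AnomalousDissipation.AnomalousDissipation.Theorems.SawtoothPulseCascade.K1Window

open MeasureTheory Set Filter Topology UnitAddTorus Function Complex Metric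
open scoped Real ENNReal
open Literature.Analysis Literature.Analysis.FunctionSpaces Literature.Analysis.FunctionSpaces.Torus Literature.Analysis.FluidPDE
open Literature.Analysis.FluidPDE.ShearStage
open Literature.Analysis.FluidPDE.SawtoothCascade Literature.Analysis.FluidPDE.SawtoothCascade.CascadeParams
open Summit.AnomalousDissipation.AnomalousDissipation.Theorems.SawtoothPulseCascade.K1Start
open Summit.AnomalousDissipation.AnomalousDissipation.Theorems.SawtoothPulseCascade.K1Flat

/-! ## The V half-step with the twist cut-off, oscillatory corner scale -/

set_option maxHeartbeats 400000 in
/-- **THE V HALF-STEP, TWIST CUT-OFF FORM, OSCILLATORY CORNER SCALE** (see the file header).  Data as in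
`…HalfStepVT.sum_window_sq_norm_vstep_twist_le` (integer strain `γ = G`, input cut-off `χ` supported in `|l| < L` with `|χ| ≤ 1`,
per-fibre symbols `ψ_n` supported in `Sψ n` with plateau `ψ_n(k₀ − l) = 1`, `k ∈ W`, `|l| < L`), kernel `L¹` constant `A ≥ ∫|k_{ψ_n}|`,
the OSCILLATORY bound `hosc` for the cut-off of the exact chirp off the corners (constants `β, φ`), the pointwise kernel bound
`hκ : |k_{ψ_n}(s)| ≤ κ/‖s‖²`, envelope scale `d₀` with `β + 16κMδ_j/(πd₀) ≤ A d₀` and `Mδ_j < πN_j d₀`, and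
`ε₀ ≥ A·2π|nG|e^{−M²/2}/(2N_j) + φ`. [cite: Grafakos2014, Prop. 3.1.2 (5), §3.1.3] -/
theorem sum_window_sq_norm_vstep_osc_le (P : CascadeParams) {G : ℕ} (hγ : P.γ = G) (hδ₀ : 0 < P.δ₀) (hd : 0 < P.d)
    (hN₀ : 1 ≤ P.N₀) (hρN : 1 ≤ P.ρN) (j : ℕ)
    {b : UnitAddTorus (Fin 2) → ℂ} (hb : Continuous b) (hbs : Summable fun k => ‖mFourierCoeff b k‖) (hb1 : ∀ x, ‖b x‖ ≤ 1)
    (W : Finset (Fin 2 → ℤ)) (χ : ℤ → ℂ) (Sχ : Finset ℤ) (hχS : ∀ l, l ∉ Sχ → χ l = 0) (hχ1 : ∀ l, ‖χ l‖ ≤ 1)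
    (L : ℕ) (hχL : ∀ l, χ l ≠ 0 → |l| < L) (ψ : ℤ → ℤ → ℂ) (Sψ : ℤ → Finset ℤ)
    (hψS : ∀ n m, m ∉ Sψ n → ψ n m = 0)
    (hψ1 : ∀ k ∈ W, ∀ l : ℤ, |l| < L → ψ (k 1) (k 0 - l) = 1)
    {d₀ M ε₀ A β φ κ : ℝ} (hd₀ : 0 < d₀) (hM : 1 ≤ M) (hMδ : M * P.δ j < π / 2) (hMd : M * P.δ j < π * P.N j * d₀)
    (hA0 : 0 ≤ A) (hA : ∀ k ∈ W, (∫ s : UnitAddCircle, ‖∑ m ∈ Sψ (k 1), ψ (k 1) m * fourier (-m) s‖) ≤ A)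
    (hosc : ∀ k ∈ W, ∀ t r : ℝ, 0 < r → (∀ m : ℤ, 2 * π * P.N j * r ≤ |2 * π * P.N j * t - (π / 2 + π * m)|) →
      ‖∫ s : UnitAddCircle, (∑ m ∈ Sψ (k 1), ψ (k 1) m * fourier (-m) s) *
        (periodic_exactChirpFun (P.N j) (k 1 * G)).lift ((t : UnitAddCircle) + s)‖ ≤ β / r + φ)
    (hκ0 : 0 ≤ κ) (hκ : ∀ k ∈ W, ∀ s : UnitAddCircle, s ≠ 0 → ‖∑ m ∈ Sψ (k 1), ψ (k 1) m * fourier (-m) s‖ ≤ κ / ‖s‖ ^ 2)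
    (hAd : β + 16 * κ * M * P.δ j / (π * d₀) ≤ A * d₀) (hε0 : 0 ≤ ε₀)
    (hε : ∀ k ∈ W, A * (2 * π * |((k 1 * G : ℤ) : ℝ)| * (Real.exp (-(M ^ 2 / 2)) / (2 * P.N j))) + φ ≤ ε₀) :
    ∑ k ∈ W, ‖mFourierCoeff (b ∘ shearMap 1 0 (amp ⟨P.U j, P.U_periodic j, P.contDiff_U (P.δ_pos hδ₀ hd j)⟩ P.γ)) k‖ ^ 2 ≤
      ((∫ s : UnitAddCircle, ‖∑ l ∈ Sχ, χ l * fourier (-l) s‖) *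
          (ε₀ + A * Real.sqrt ((2 * P.N j : ℕ) * (4 * d₀))) +
        Real.sqrt (∑ n ∈ W.image (fun k => k 1), ∫ x : UnitAddTorus (Fin 2),
          ‖∫ s : UnitAddCircle, (fourier (-n) s : ℂ) •
            (b (x + Pi.single (1 : Fin 2) s) - ∑ l ∈ Sχ, χ l * ∫ s' : UnitAddCircle,
              (fourier (-l) s' : ℂ) • b (x + Pi.single (1 : Fin 2) s + Pi.single (0 : Fin 2) s'))‖ ^ 2)) ^ 2 := by
  classical
  have h10 : (1 : Fin 2) ≠ 0 := by decide
  have hπ : 0 < π := Real.pi_pos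
  have hN : P.N j ≠ 0 := (N_pos P hN₀ hρN j).ne'
  have hNpos : 0 < P.N j := Nat.pos_of_ne_zero hN
  have hNr : (0 : ℝ) < P.N j := by exact_mod_cast hNpos
  have hc : 0 < 2 * π * (P.N j : ℝ) := by positivity
  have hI : ∀ {f : UnitAddCircle → ℂ}, Continuous f → Integrable f := fun hf =>
    hf.integrable_of_hasCompactSupport (HasCompactSupport.of_compactSpace _)
  set Ψ : ShearProfile := amp ⟨P.U j, P.U_periodic j, P.contDiff_U (P.δ_pos hδ₀ hd j)⟩ P.γ with hΨ
  have hΨt : ∀ t : ℝ, Ψ t = P.γ * P.U j t := fun t => amp_apply _ _ _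
  -- the input cut-off and its complement
  set T : UnitAddTorus (Fin 2) → ℂ := fun x => ∑ l ∈ Sχ, χ l *
    ∫ s : UnitAddCircle, (fourier (-l) s : ℂ) • b (x + Pi.single (0 : Fin 2) s) with hT
  have hTc : Continuous T := continuous_finsetSum _ fun l _ => continuous_const.mul (continuous_twistedAxisAvg hb 0 l)
  have hTcoef : ∀ k, mFourierCoeff T k = χ (k 0) * mFourierCoeff b k := fun k => mFourierCoeff_axisCutoff hb 0 hχS k
  have hTs : Summable fun k => ‖mFourierCoeff T k‖ := by
    refine Summable.of_nonneg_of_le (fun k => norm_nonneg _) (fun k => ?_) hbs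
    rw [hTcoef k, norm_mul]
    exact mul_le_of_le_one_left (norm_nonneg _) (hχ1 _)
  set θ₂ : UnitAddTorus (Fin 2) → ℂ := fun x => b x - T x with hθ₂
  have hθ₂c : Continuous θ₂ := hb.sub hTc
  have hsum : (fun x => T x + θ₂ x) = b := by funext x; simp [hθ₂]
  -- the exact chirps, the circle kernels, the twist cut-off
  set g0 : ℤ → UnitAddCircle → ℂ := fun n => (periodic_exactChirpFun (P.N j) (n * G)).lift with hg0
  have hg0c : ∀ n, Continuous (g0 n) := fun n => (continuous_exactChirp_lift (P.N j) (n * G)).1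
  have hg0t : ∀ n (t : ℝ), g0 n (t : UnitAddCircle) =
      Complex.exp (-(2 * π * I * ((n * G : ℤ)) * ((tri (2 * π * P.N j * t) / (2 * π * P.N j) : ℝ) : ℂ))) :=
    fun n t => (continuous_exactChirp_lift (P.N j) (n * G)).2 t
  have hg01 : ∀ n bb, ‖g0 n bb‖ ≤ 1 := by
    intro n bb
    obtain ⟨t, rfl⟩ := QuotientAddGroup.mk_surjective bb
    rw [hg0t]; exact norm_exp_chirp_le _ _
  have htw1 : ∀ n bb, ‖twist Ψ n bb‖ ≤ 1 := fun n bb => (norm_twist Ψ n bb).le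
  set kψ : ℤ → UnitAddCircle → ℂ := fun n s => ∑ m ∈ Sψ n, ψ n m * fourier (-m) s with hkψ
  have hkψc : ∀ n, Continuous (kψ n) := fun n =>
    continuous_finsetSum _ fun m _ => continuous_const.mul (fourier (-m)).continuous
  set gmid : ℤ → UnitAddCircle → ℂ := fun n bb => ∫ s : UnitAddCircle, kψ n s * twist Ψ n (bb + s) with hgmid
  set grest : ℤ → UnitAddCircle → ℂ := fun n bb => twist Ψ n bb - ∫ s : UnitAddCircle, kψ n s * twist Ψ n (bb + s)
    with hgrest
  have hgmidc : ∀ n, Continuous (gmid n) := fun n => continuous_circleCutoff (hkψc n) (continuous_twist Ψ n)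
  have hgrestc : ∀ n, Continuous (grest n) := fun n =>
    (continuous_twist Ψ n).sub (continuous_circleCutoff (hkψc n) (continuous_twist Ψ n))
  have hsplit : ∀ k ∈ W, ∀ bb, twist Ψ (k 1) bb = gmid (k 1) bb + grest (k 1) bb := by
    intro k _ bb; simp only [hgmid, hgrest]; ring
  -- exact separation
  have hsep : ∀ k ∈ W, ∀ m : ℤ, fourierCoeff (grest (k 1)) m * mFourierCoeff T (k - Pi.single 0 m) = 0 := by
    intro k hk m
    rw [hTcoef]
    have e0 : (k - Pi.single (0 : Fin 2) m : Fin 2 → ℤ) 0 = k 0 - m := by simp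
    rw [e0]
    by_cases hχ0 : χ (k 0 - m) = 0
    · rw [hχ0, zero_mul, mul_zero]
    · have hl : |k 0 - m| < L := hχL _ hχ0
      have hψm : ψ (k 1) m = 1 := by
        have := hψ1 k hk (k 0 - m) hl
        rwa [show k 0 - (k 0 - m) = m by ring] at this
      have hcoef : fourierCoeff (grest (k 1)) m = 0 := by
        simp only [hgrest]
        rw [fourierCoeff_sub_of_continuous (continuous_twist Ψ _)
            (continuous_circleCutoff (hkψc _) (continuous_twist Ψ _)),
          show (fun y : UnitAddCircle => ∫ s : UnitAddCircle, kψ (k 1) s * twist Ψ (k 1) (y + s)) =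
            (fun y : UnitAddCircle => ∫ s : UnitAddCircle, (∑ m' ∈ Sψ (k 1), ψ (k 1) m' * fourier (-m') s) *
              twist Ψ (k 1) (y + s)) from rfl,
          fourierCoeff_circleCutoff (continuous_twist Ψ _) (hψS (k 1)) m, hψm, one_mul, sub_self]
      rw [hcoef, zero_mul]
  -- the corner set, the majorant
  set CF : Finset UnitAddCircle := (Finset.Ico (0 : ℤ) (2 * P.N j)).image
      fun l : ℤ => (((2 * (l : ℝ) + 1) / (4 * P.N j) : ℝ) : UnitAddCircle) with hCF
  have hCFne : CF.Nonempty :=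
    Finset.Nonempty.image ⟨0, Finset.mem_Ico.mpr ⟨le_rfl, by exact_mod_cast (by omega : 0 < 2 * P.N j)⟩⟩ _
  have hCFcard : (CF.card : ℝ) ≤ (2 * P.N j : ℕ) := by
    have h1 : CF.card ≤ (Finset.Ico (0 : ℤ) (2 * P.N j)).card := Finset.card_image_le
    rw [Int.card_Ico] at h1
    exact_mod_cast (by omega : CF.card ≤ 2 * P.N j)
  set C : Set UnitAddCircle := (CF : Set UnitAddCircle) with hC
  set ρ : UnitAddCircle → ℝ := fun bb => ε₀ + A * (d₀ / max (infDist bb C) d₀) with hρ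
  obtain ⟨hρc, hρ0, hρcore, hρoff⟩ := envelope_facts C hε0 hA0 hd₀
  -- the rounding remainder off the `Mδ`-zone
  have hround : ∀ k ∈ W, ∀ u : ℝ, (∀ m : ℤ, M * P.δ j < |2 * π * P.N j * u - (π / 2 + π * m)|) →
      ‖twist Ψ (k 1) ((u : ℝ) : UnitAddCircle) - g0 (k 1) (u : UnitAddCircle)‖ ≤
        2 * π * |((k 1 * G : ℤ) : ℝ)| * (Real.exp (-(M ^ 2 / 2)) / (2 * P.N j)) := by
    intro k hk u hfar2
    have hU := abs_U_sub_tri_le_of_far P hδ₀ hd hN₀ hρN hM hMδ hfar2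
    rw [twist_coe, hΨt, hγ, hg0t]
    have e1 : -(2 * ↑π * I * ((k 1 : ℤ) : ℂ) * (((G : ℝ) * P.U j u : ℝ) : ℂ)) =
        -(2 * π * I * (((k 1 * G : ℤ) : ℝ) : ℂ) * ((P.U j u : ℝ) : ℂ)) := by push_cast; ring
    have e2 : -(2 * ↑π * I * ((k 1 * G : ℤ) : ℂ) * ((tri (2 * π * P.N j * u) / (2 * π * P.N j) : ℝ) : ℂ)) =
        -(2 * π * I * (((k 1 * G : ℤ) : ℝ) : ℂ) * ((tri (2 * π * P.N j * u) / (2 * π * P.N j) : ℝ) : ℂ)) := by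
      push_cast; ring
    rw [e1, e2]
    refine (norm_exp_chirp_sub_le _ _ _).trans ?_
    exact mul_le_mul_of_nonneg_left hU (by positivity)
  have hbd : ∀ k ∈ W, ∀ bb, ‖gmid (k 1) bb‖ ≤ ρ bb := by
    intro k hk bb
    have hkA := hA k hk
    have hkψ1 : (∫ s : UnitAddCircle, ‖kψ (k 1) s‖) ≤ A := by simpa only [hkψ] using hkA
    -- the bound `A`, valid everywhere
    have hcrude : ‖gmid (k 1) bb‖ ≤ A := by
      have h1 : ‖∫ s : UnitAddCircle, kψ (k 1) s * twist Ψ (k 1) (bb + s)‖ ≤ (∫ s : UnitAddCircle, ‖kψ (k 1) s‖) * 1 :=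
        norm_circleCutoff_le (hkψc _) (continuous_twist Ψ _) (htw1 _) bb
      simp only [hgmid]
      linarith
    by_cases hcore : infDist bb C ≤ d₀
    · simp only [hρ]
      rw [hρcore bb hcore]
      linarith [hcrude]
    · -- off the core: `ψ⋆g = ψ⋆g₀ + ψ⋆(g − g₀)`; the oscillatory bound for the first, `η` off the corner zones for the second
      push Not at hcore
      have hdpos : 0 < infDist bb C := hd₀.trans hcore
      obtain ⟨t, rfl⟩ := QuotientAddGroup.mk_surjective bb
      set Id : ℝ := infDist ((t : ℝ) : UnitAddCircle) C with hId
      have hfar := phase_far_of_le_infDist hNpos (le_refl Id)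
      -- first piece: the oscillatory bound
      have h1' : ‖∫ s : UnitAddCircle, kψ (k 1) s * g0 (k 1) ((t : UnitAddCircle) + s)‖ ≤ β / Id + φ := by
        simpa only [hkψ, hg0] using hosc k hk t Id hdpos hfar
      -- second piece: `η` off the zones, `2` on the zones; the zones are `≥ Id/2` away and have measure `≤ 2Mδ_j/π`
      set η : ℝ := 2 * π * |((k 1 * G : ℤ) : ℝ)| * (Real.exp (-(M ^ 2 / 2)) / (2 * P.N j)) with hη
      have hη0 : 0 ≤ η := by positivity
      set rM : ℝ := M * P.δ j / (2 * π * P.N j) with hrM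
      have hrM0 : 0 ≤ rM := by
        have := (P.δ_pos hδ₀ hd j).le
        positivity
      have hrMd : 2 * rM < d₀ := by
        rw [hrM, show 2 * (M * P.δ j / (2 * π * P.N j)) = M * P.δ j / (π * P.N j) by field_simp,
          div_lt_iff₀ (by positivity)]
        linarith
      set hf : UnitAddCircle → ℂ := fun s => twist Ψ (k 1) ((t : UnitAddCircle) + s) - g0 (k 1) ((t : UnitAddCircle) + s)
        with hhf
      have hh : Continuous hf :=
        ((continuous_twist Ψ _).comp (continuous_const_add _)).sub ((hg0c _).comp (continuous_const_add _))
      set B : Set UnitAddCircle := {s | infDist ((t : UnitAddCircle) + s) C ≤ rM} with hB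
      have hBm : MeasurableSet B :=
        (isClosed_le ((continuous_infDist_pt C).comp (continuous_const.add continuous_id)) continuous_const).measurableSet
      -- off `B` the rounded twist is `η`-close to the exact chirp
      have hoffB : ∀ s, s ∉ B → ‖hf s‖ ≤ η := by
        intro s hs
        rw [hB, Set.mem_setOf_eq, not_le] at hs
        obtain ⟨s', rfl⟩ := QuotientAddGroup.mk_surjective s
        have e : ((t : ℝ) : UnitAddCircle) + (QuotientAddGroup.mk s' : UnitAddCircle) = (((t + s' : ℝ)) : UnitAddCircle) := rfl
        simp only [hhf]
        rw [e]
        refine hround k hk (t + s') fun m => ?_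
        have hph := phase_far_of_le_infDist hNpos (le_refl (infDist (((t + s' : ℝ)) : UnitAddCircle) C)) m
        rw [e] at hs
        have : M * P.δ j < 2 * π * P.N j * infDist (((t + s' : ℝ)) : UnitAddCircle) C := by
          rw [hrM, div_lt_iff₀ (by positivity)] at hs; linarith
        linarith
      have hfarB : ∀ s, ‖hf s‖ ≤ 2 := fun s => by
        refine (norm_sub_le _ _).trans ?_
        have := hg01 (k 1) ((t : UnitAddCircle) + s)
        have := htw1 (k 1) ((t : UnitAddCircle) + s)
        linarith
      -- on `B`, `‖s‖ ≥ Id/2`, so the kernel is `≤ 4κ/Id²`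
      have hBfar : ∀ s ∈ B, Id / 2 ≤ ‖s‖ := by
        intro s hs
        rw [hB, Set.mem_setOf_eq] at hs
        have hdrop := infDist_sub_norm_le_infDist_add C ((t : ℝ) : UnitAddCircle) s
        linarith
      have hkB : ∀ s ∈ B, ‖kψ (k 1) s‖ ≤ 4 * κ / Id ^ 2 := by
        intro s hs
        have hs2 := hBfar s hs
        have hs0 : s ≠ 0 := by
          intro h0; rw [h0, norm_zero] at hs2; linarith
        have hk := hκ k hk s hs0
        simp only [hkψ] at hk ⊢
        refine hk.trans ?_
        have hns : 0 < ‖s‖ := norm_pos_iff.mpr hs0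
        rw [div_le_div_iff₀ (by positivity) (by positivity)]
        have hsq : Id ^ 2 ≤ 4 * ‖s‖ ^ 2 := by nlinarith [hdpos.le]
        nlinarith [mul_le_mul_of_nonneg_left hsq hκ0]
      -- the measure of `B`: at most `2N_j` balls of radius `rM`
      have hBsub : B ⊆ ⋃ c ∈ CF, Metric.closedBall (c - ((t : ℝ) : UnitAddCircle)) rM := by
        intro s hs
        rw [hB, Set.mem_setOf_eq] at hs
        have hCc : IsCompact C := by rw [hC]; exact CF.finite_toSet.isCompact
        have hCne : C.Nonempty := by rw [hC]; exact_mod_cast hCFne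
        obtain ⟨c, hc, hcd⟩ := hCc.exists_infDist_eq_dist hCne (((t : ℝ) : UnitAddCircle) + s)
        rw [hC] at hc
        refine Set.mem_iUnion₂.mpr ⟨c, by exact_mod_cast hc, ?_⟩
        rw [Metric.mem_closedBall, dist_eq_norm, show s - (c - ((t : ℝ) : UnitAddCircle)) =
          ((t : ℝ) : UnitAddCircle) + s - c by abel, ← dist_eq_norm, ← hcd]
        exact hs
      have hBvol : volume.real B ≤ (2 * P.N j : ℕ) * (2 * rM) := by
        refine (measureReal_mono hBsub (measure_ne_top _ _)).trans ((measureReal_biUnion_finset_le CF _).trans ?_)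
        have hball : ∀ c ∈ CF, volume.real (Metric.closedBall (c - ((t : ℝ) : UnitAddCircle)) rM) ≤ 2 * rM := by
          intro c _
          rw [Measure.real, AddCircle.volume_closedBall, ENNReal.toReal_ofReal (le_min zero_le_one (by linarith))]
          exact min_le_right _ _
        refine (Finset.sum_le_sum hball).trans ?_
        rw [Finset.sum_const, nsmul_eq_mul]
        exact mul_le_mul_of_nonneg_right hCFcard (by linarith)
      -- integrate
      have hkn : Integrable fun s : UnitAddCircle => ‖kψ (k 1) s‖ := (hI (hkψc _)).norm
      have hpt : ∀ s : UnitAddCircle, ‖kψ (k 1) s * hf s‖ ≤ η * ‖kψ (k 1) s‖ + 2 * B.indicator (fun s => ‖kψ (k 1) s‖) s := by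
        intro s
        rw [norm_mul]
        by_cases hs : s ∈ B
        · rw [Set.indicator_of_mem hs]
          have := hfarB s
          nlinarith [norm_nonneg (kψ (k 1) s), norm_nonneg (hf s)]
        · rw [Set.indicator_of_notMem hs, mul_zero, add_zero, mul_comm]
          exact mul_le_mul_of_nonneg_right (hoffB s hs) (norm_nonneg _)
      have hI1 : Integrable fun s : UnitAddCircle => ‖kψ (k 1) s * hf s‖ := (hI ((hkψc _).mul hh)).norm
      have hI2 : Integrable fun s : UnitAddCircle => η * ‖kψ (k 1) s‖ := hkn.const_mul η
      have hI3 : Integrable fun s : UnitAddCircle => 2 * B.indicator (fun s => ‖kψ (k 1) s‖) s :=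
        (hkn.indicator hBm).const_mul 2
      have hstep1 : ∫ s : UnitAddCircle, ‖kψ (k 1) s * hf s‖ ≤
          ∫ s : UnitAddCircle, (η * ‖kψ (k 1) s‖ + 2 * B.indicator (fun s => ‖kψ (k 1) s‖) s) :=
        integral_mono hI1 (hI2.add hI3) hpt
      have hstep2 : ∫ s : UnitAddCircle, (η * ‖kψ (k 1) s‖ + 2 * B.indicator (fun s => ‖kψ (k 1) s‖) s) =
          η * (∫ s : UnitAddCircle, ‖kψ (k 1) s‖) + 2 * ∫ s in B, ‖kψ (k 1) s‖ := by
        rw [integral_add hI2 hI3, integral_const_mul, integral_const_mul, integral_indicator hBm]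
      have hA' : η * ∫ s : UnitAddCircle, ‖kψ (k 1) s‖ ≤ η * A := mul_le_mul_of_nonneg_left hkψ1 hη0
      have hBint : ∫ s in B, ‖kψ (k 1) s‖ ≤ 4 * κ / Id ^ 2 * volume.real B := by
        have h := norm_setIntegral_le_of_norm_le_const (measure_lt_top volume B) (f := fun s : UnitAddCircle => ‖kψ (k 1) s‖)
          (C := 4 * κ / Id ^ 2) (fun s hs => by rw [Real.norm_eq_abs, abs_of_nonneg (norm_nonneg _)]; exact hkB s hs)
        exact (le_abs_self _).trans ((Real.norm_eq_abs _).symm.le.trans h)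
      have h4 : 0 ≤ 4 * κ / Id ^ 2 := by positivity
      have hBint' : ∫ s in B, ‖kψ (k 1) s‖ ≤ 4 * κ / Id ^ 2 * ((2 * P.N j : ℕ) * (2 * rM)) :=
        hBint.trans (mul_le_mul_of_nonneg_left hBvol h4)
      have hr2 : ((2 * P.N j : ℕ) : ℝ) * (2 * rM) = 2 * M * P.δ j / π := by
        rw [hrM]; push_cast; field_simp
      have hconst : 2 * (4 * κ / Id ^ 2 * ((2 * P.N j : ℕ) * (2 * rM))) = 16 * κ * M * P.δ j / (π * Id ^ 2) := by
        rw [hr2]; ring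
      have h2' : ‖∫ s : UnitAddCircle, kψ (k 1) s * hf s‖ ≤ η * A + 16 * κ * M * P.δ j / (π * Id ^ 2) :=
        calc ‖∫ s : UnitAddCircle, kψ (k 1) s * hf s‖ ≤ ∫ s : UnitAddCircle, ‖kψ (k 1) s * hf s‖ :=
              norm_integral_le_integral_norm _
          _ ≤ η * A + 2 * (4 * κ / Id ^ 2 * ((2 * P.N j : ℕ) * (2 * rM))) := by linarith [hstep1, hstep2, hA', hBint']
          _ = η * A + 16 * κ * M * P.δ j / (π * Id ^ 2) := by rw [hconst]
      -- the decomposition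
      have hdec : gmid (k 1) ((t : ℝ) : UnitAddCircle) =
          (∫ s : UnitAddCircle, kψ (k 1) s * g0 (k 1) ((t : UnitAddCircle) + s)) +
            ∫ s : UnitAddCircle, kψ (k 1) s * hf s := by
        have hIa : Integrable fun s : UnitAddCircle => kψ (k 1) s * g0 (k 1) ((t : UnitAddCircle) + s) :=
          hI ((hkψc _).mul ((hg0c _).comp (continuous_const_add _)))
        have hIb : Integrable fun s : UnitAddCircle => kψ (k 1) s * hf s := hI ((hkψc _).mul hh)
        simp only [hgmid]
        rw [← integral_add hIa hIb]
        refine integral_congr_ae (Eventually.of_forall fun s => ?_)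
        simp only [hhf]
        ring
      -- compare with the envelope off the core
      have hkε := hε k hk
      simp only [hρ]
      rw [hρoff _ hcore.le, hdec]
      refine (norm_add_le _ _).trans ?_
      have hId0 : d₀ ≤ Id := hcore.le
      have hmain : β / Id + 16 * κ * M * P.δ j / (π * Id ^ 2) ≤ A * d₀ / Id := by
        have h3 : 16 * κ * M * P.δ j / (π * Id ^ 2) ≤ (16 * κ * M * P.δ j / (π * d₀)) / Id := by
          rw [div_div, div_le_div_iff₀ (by positivity) (by positivity)]
          have hnum : 0 ≤ 16 * κ * M * P.δ j := by
            have := (P.δ_pos hδ₀ hd j).le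
            have : (0 : ℝ) ≤ M := by linarith
            positivity
          have : π * d₀ * Id ≤ π * Id ^ 2 := by nlinarith [mul_nonneg (mul_nonneg hπ.le hdpos.le) (sub_nonneg.mpr hId0)]
          exact mul_le_mul_of_nonneg_left this hnum
        have h4 : β / Id + (16 * κ * M * P.δ j / (π * d₀)) / Id ≤ A * d₀ / Id := by
          rw [← add_div]; exact div_le_div_of_nonneg_right hAd hdpos.le
        linarith
      have hηε : η * A + φ ≤ ε₀ := by rw [mul_comm]; exact hkε
      linarith [h1', h2', hmain, hηε]
  -- the window lemma
  have hmain := sum_window_sq_norm_comp_shearMap_le_fibre hTc hTs hθ₂c h10 Ψ W gmid grest hgmidc hgrestc hsplit hsep hρc hρ0 hbd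
  rw [hsum] at hmain
  refine hmain.trans (pow_le_pow_left₀ (by positivity) (add_le_add ?_ le_rfl) 2)
  -- the zone term: kernel `L¹` norm × envelope amplitude
  have hZ : ∫ x : UnitAddTorus (Fin 2), ρ (x 0) ^ 2 * ‖T x‖ ^ 2 ≤
      (∫ s : UnitAddCircle, ‖∑ l ∈ Sχ, χ l * fourier (-l) s‖) ^ 2 * 1 ^ 2 * ∫ bb : UnitAddCircle, ρ bb ^ 2 :=
    integral_weight_mul_norm_axisCutoff_sq_le hb hb1 0 χ Sχ hρc
  have hK0 : 0 ≤ ∫ s : UnitAddCircle, ‖∑ l ∈ Sχ, χ l * fourier (-l) s‖ := integral_nonneg fun s => norm_nonneg _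
  have hS0 : 0 ≤ ε₀ + A * Real.sqrt ((2 * P.N j : ℕ) * (4 * d₀)) := by positivity
  have hρ2 : ∫ bb : UnitAddCircle, ρ bb ^ 2 ≤ (ε₀ + A * Real.sqrt ((2 * P.N j : ℕ) * (4 * d₀))) ^ 2 := by
    have h := integral_envelope_sq_le_sq CF hCFne hε0 hA0 hd₀
    refine h.trans (pow_le_pow_left₀ (by positivity) (add_le_add le_rfl (mul_le_mul_of_nonneg_left
      (Real.sqrt_le_sqrt (mul_le_mul_of_nonneg_right hCFcard (by positivity))) hA0)) 2)
  calc Real.sqrt (∫ x : UnitAddTorus (Fin 2), ρ (x 0) ^ 2 * ‖T x‖ ^ 2)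
      ≤ Real.sqrt (((∫ s : UnitAddCircle, ‖∑ l ∈ Sχ, χ l * fourier (-l) s‖) *
          (ε₀ + A * Real.sqrt ((2 * P.N j : ℕ) * (4 * d₀)))) ^ 2) := by
        refine Real.sqrt_le_sqrt (hZ.trans ?_)
        rw [one_pow, mul_one, mul_pow]
        exact mul_le_mul_of_nonneg_left hρ2 (sq_nonneg _)
    _ = (∫ s : UnitAddCircle, ‖∑ l ∈ Sχ, χ l * fourier (-l) s‖) *
          (ε₀ + A * Real.sqrt ((2 * P.N j : ℕ) * (4 * d₀))) := Real.sqrt_sq (mul_nonneg hK0 hS0)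

end Summit.AnomalousDissipation.AnomalousDissipation.Theorems.SawtoothPulseCascade.K1Window
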